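import Mathlib
import HarnessLib
import Summits.CriticalPhenomena.CardyFormulaZ2.Theses.CardyMagicRigidity
import Summits.CriticalPhenomena.CardyFormulaZ2.Theorems.CardyMagicRigidityNestingRigidityOneGenerationTInterior
import Literature.Probability.Percolation.FullPlaneCNL
import Literature.Probability.Percolation.LoopTraversalBound
import Literature.Probability.RandomPlanarGeometry.NestingTransform
import Literature.Probability.RandomPlanarGeometry.UnbasedLoopImage

/-!
# The dilation identity `Λ^𝕋_δ(f) = Λ^𝕋_1(f_δ)` (line `Sketch`, stub `stub_dilation`)

Crux `Summit.CriticalPhenomena.CardyFormulaZ2.Theses.CardyMagicRigidity.MagicFormulaT`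
(stmt-CriticalPhenomena-4836), line `Sketch` (card `kac-window-vertex-operators`), stub `stub_dilation`
of the registered skeleton `Cruxes/MagicFormulaT/Lines/Sketch.lean`: the EXACT lattice identity

  `E_{1/2}[∏_{u interface loop of δ𝕋} 2cos(∫_{W(u,·)≠0} f + π/3)]`
    `= E_{1/2}[∏_{u interface loop of 𝕋} 2cos(∫_{W(u,·)≠0} δ² f(δ·) + π/3)]`

for every `f : ℂ → ℝ` and every `δ > 0` (no measurability or integrability hypotheses: the
set-integral change of variables and the `finprod` junk conventions agree on both sides).

Proof.  Configuration by configuration the two finite products agree: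
* the drawn interface loop at mesh `δ` is the image of the drawn loop at mesh `1` under the
  dilation `z ↦ δ z` of unbased loops (`UnbasedLoop.imageOn (δ * ·) univ`, `imageOn_mul_siteLoop`;
  pointwise `hexLoopCurve δ γ = δ · hexLoopCurve 1 γ`, `hexLoopCurve_eq_map`), so the index set at
  mesh `δ` is the image of the index set at mesh `1` (`loopSet_eq_image`) under an injective map
  (`imageOn_mul_injective`: the dilation by `δ⁻¹` is a left inverse, `UnbasedLoop.imageOn_imageOn`),
  and `finprod_mem_image` applies;
* winding numbers are covariant, junk values included: `W(δu, δz) = W(u, z)` for ALL `z`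
  (`Curve.wind_map_affine`), whence `{W(δu, ·) ≠ 0} = δ • {W(u, ·) ≠ 0}` (`setOf_wind_imageOn_mul_ne_zero`);
* `∫_{δ • A} f = ∫_A δ² f(δ ·)` for every `f` and `A` (`Measure.setIntegral_comp_smul_of_pos` with
  `finrank ℝ ℂ = 2`; both sides are junk `0` together), `setIntegral_smul_set_eq`.

No named facts are used; everything is proved tree / Mathlib material.
-/

noncomputable section

namespace Summit.CriticalPhenomena.CardyFormulaZ2.Cruxes.MagicFormulaT.LineSketch

open MeasureTheory Filter Set Metric
open scoped Pointwise
open Literature.Probability.RandomPlanarGeometry Literature.Probability.Percolation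
  Literature.Probability.LatticeModels
open Summit.CriticalPhenomena.CardyFormulaZ2.Cruxes.NestingRigidity.MarkovCascadeOneGeneration
  (hexLoopCurve_eq_map)

/-! ## Dilation of curves and unbased loops -/

/-- Two based loops with equal underlying curve classes are equal (proof irrelevance). -/
theorem basedLoop_mk_congr {c c' : CurveClass ℂ} (h : c = c') (hc : c.IsLoop) (hc' : c'.IsLoop) :
    BasedLoop.mk c hc = BasedLoop.mk c' hc' := by
  subst h
  rfl

/-- On curves, `Curve.imageOn (δ * ·) univ` is the push-forward along the similarity `z ↦ δ z + 0`. -/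
theorem curve_imageOn_mul_eq_map (δ : ℝ) (γ : Curve ℂ) :
    γ.imageOn (fun z ↦ (δ : ℂ) * z) univ = γ.map ⟨fun z ↦ (δ : ℂ) * z + 0, by fun_prop⟩ := by
  apply DFunLike.coe_injective
  funext t
  rw [Curve.imageOn_apply (by fun_prop) (subset_univ _), Curve.map_apply, ContinuousMap.coe_mk,
    add_zero]

/-- **The drawn loop at mesh `δ` is the `δ`-dilate of the drawn loop at mesh `1`**, as unbased loops. -/
theorem imageOn_mul_siteLoop (δ : ℝ) {v : HexVertex} (γ : hexGraph.Walk v v) :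
    UnbasedLoop.imageOn (fun z ↦ (δ : ℂ) * z) univ
        (UnbasedLoop.mk (BasedLoop.mk (siteLoopCurve 1 γ) (isLoop_siteLoopCurve 1 γ))) =
      UnbasedLoop.mk (BasedLoop.mk (siteLoopCurve δ γ) (isLoop_siteLoopCurve δ γ)) := by
  rw [UnbasedLoop.imageOn_mk]
  refine congrArg UnbasedLoop.mk ?_
  change BasedLoop.mk ((BasedLoop.mk (siteLoopCurve 1 γ) (isLoop_siteLoopCurve 1 γ)).toCurveClass.imageOn
    (fun z ↦ (δ : ℂ) * z) univ) _ = _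
  apply basedLoop_mk_congr
  rw [BasedLoop.toCurveClass_mk]
  change (CurveClass.mk (hexLoopCurve 1 γ)).imageOn (fun z ↦ (δ : ℂ) * z) univ =
    CurveClass.mk (hexLoopCurve δ γ)
  rw [CurveClass.imageOn_mk, curve_imageOn_mul_eq_map, ← hexLoopCurve_eq_map]

/-- The dilation by `δ ≠ 0` of unbased loops is injective (the dilation by `δ⁻¹` is a left inverse). -/
theorem imageOn_mul_injective {δ : ℝ} (hδ : δ ≠ 0) :
    Function.Injective (UnbasedLoop.imageOn (fun z ↦ (δ : ℂ) * z) (univ : Set ℂ)) := by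
  refine Function.LeftInverse.injective
    (g := UnbasedLoop.imageOn (fun z ↦ ((δ : ℂ)⁻¹) * z) (univ : Set ℂ)) fun u ↦ ?_
  exact UnbasedLoop.imageOn_imageOn (by fun_prop) (by fun_prop) (mapsTo_univ _ _)
    (fun z _ ↦ inv_mul_cancel_left₀ (Complex.ofReal_ne_zero.2 hδ) z) (subset_univ _)

/-- **Winding numbers are scale covariant, junk values included**: `W(δu, δz) = W(u, z)` for every
unbased loop `u`, every `z : ℂ` and every `δ ≠ 0` (`Curve.wind_map_affine`). -/
theorem wind_imageOn_mul {δ : ℝ} (hδ : δ ≠ 0) (u : UnbasedLoop ℂ) (z : ℂ) :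
    (UnbasedLoop.imageOn (fun z ↦ (δ : ℂ) * z) univ u).wind ((δ : ℂ) * z) = u.wind z := by
  obtain ⟨⟨c, hc⟩, rfl⟩ := UnbasedLoop.mk_surjective u
  obtain ⟨γ, rfl⟩ := CurveClass.surjective_mk c
  rw [UnbasedLoop.imageOn_mk, UnbasedLoop.wind_mk, UnbasedLoop.wind_mk,
    BasedLoop.toCurveClass_imageOn]
  change CurveClass.wind ((CurveClass.mk γ).imageOn (fun z ↦ (δ : ℂ) * z) univ) ((δ : ℂ) * z) =
    CurveClass.wind (CurveClass.mk γ) z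
  rw [CurveClass.imageOn_mk, CurveClass.wind_mk, CurveClass.wind_mk, curve_imageOn_mul_eq_map,
    ← Curve.wind_map_affine γ (Complex.ofReal_ne_zero.2 hδ) 0 z, add_zero]

/-- **Interiors dilate**: `{z | W(δu, z) ≠ 0} = δ • {z | W(u, z) ≠ 0}` for `δ > 0`. -/
theorem setOf_wind_imageOn_mul_ne_zero {δ : ℝ} (hδ : 0 < δ) (u : UnbasedLoop ℂ) :
    {z : ℂ | (UnbasedLoop.imageOn (fun z ↦ (δ : ℂ) * z) univ u).wind z ≠ 0} =
      δ • {z : ℂ | u.wind z ≠ 0} := by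
  ext z
  rw [Set.mem_smul_set]
  constructor
  · intro hz
    refine ⟨(δ : ℂ)⁻¹ * z, ?_, ?_⟩
    · rw [mem_setOf_eq, ← wind_imageOn_mul hδ.ne',
        mul_inv_cancel_left₀ (Complex.ofReal_ne_zero.2 hδ.ne')]
      exact hz
    · rw [Complex.real_smul, mul_inv_cancel_left₀ (Complex.ofReal_ne_zero.2 hδ.ne')]
  · rintro ⟨y, hy, rfl⟩
    rw [mem_setOf_eq, Complex.real_smul, wind_imageOn_mul hδ.ne']
    exact hy

/-! ## Change of variables in the set integral -/

/-- **`∫_{δ • A} f = ∫_A δ² f(δ ·)`** on `ℂ` for `δ > 0`, for every `f : ℂ → ℝ` and every `A`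
(`Measure.setIntegral_comp_smul_of_pos`, `finrank ℝ ℂ = 2`; no integrability needed). -/
theorem setIntegral_smul_set_eq (f : ℂ → ℝ) {δ : ℝ} (hδ : 0 < δ) (A : Set ℂ) :
    ∫ z in δ • A, f z = ∫ z in A, δ ^ 2 * f ((δ : ℂ) * z) := by
  have h := Measure.setIntegral_comp_smul_of_pos volume f A hδ
  rw [Complex.finrank_real_complex, smul_eq_mul] at h
  simp only [Complex.real_smul] at h
  rw [integral_const_mul, h, ← mul_assoc, mul_inv_cancel₀ (pow_ne_zero 2 hδ.ne'), one_mul]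

/-! ## The identity, configuration by configuration -/

/-- The index set at mesh `δ` is the image of the index set at mesh `1` under the dilation of
unbased loops. -/
theorem loopSet_eq_image (δ : ℝ) (cfg : SiteConfig (Site 2)) :
    {u : UnbasedLoop ℂ | ∃ (v : HexVertex) (γ : hexGraph.Walk v v),
        IsSiteInterfaceLoop cfg γ ∧
          u = UnbasedLoop.mk (BasedLoop.mk (siteLoopCurve δ γ) (isLoop_siteLoopCurve δ γ))} =
      UnbasedLoop.imageOn (fun z ↦ (δ : ℂ) * z) univ ''
        {u : UnbasedLoop ℂ | ∃ (v : HexVertex) (γ : hexGraph.Walk v v),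
          IsSiteInterfaceLoop cfg γ ∧
            u = UnbasedLoop.mk (BasedLoop.mk (siteLoopCurve 1 γ) (isLoop_siteLoopCurve 1 γ))} := by
  ext u
  simp only [mem_image, mem_setOf_eq]
  constructor
  · rintro ⟨v, γ, hγ, rfl⟩
    exact ⟨_, ⟨v, γ, hγ, rfl⟩, imageOn_mul_siteLoop δ γ⟩
  · rintro ⟨u', ⟨v, γ, hγ, rfl⟩, rfl⟩
    exact ⟨v, γ, hγ, imageOn_mul_siteLoop δ γ⟩

/-- **The dilation identity for one configuration**: the weight of `cfg` at mesh `δ` with density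
`f` equals its weight at mesh `1` with density `δ² f(δ ·)`. -/
theorem finprod_loopWeight_dilate (f : ℂ → ℝ) {δ : ℝ} (hδ : 0 < δ) (cfg : SiteConfig (Site 2)) :
    ∏ᶠ u ∈ {u : UnbasedLoop ℂ | ∃ (v : HexVertex) (γ : hexGraph.Walk v v),
        IsSiteInterfaceLoop cfg γ ∧
          u = UnbasedLoop.mk (BasedLoop.mk (siteLoopCurve δ γ) (isLoop_siteLoopCurve δ γ))},
        2 * Real.cos ((∫ z in {z : ℂ | u.wind z ≠ 0}, f z) + Real.pi / 3) =
      ∏ᶠ u ∈ {u : UnbasedLoop ℂ | ∃ (v : HexVertex) (γ : hexGraph.Walk v v),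
        IsSiteInterfaceLoop cfg γ ∧
          u = UnbasedLoop.mk (BasedLoop.mk (siteLoopCurve 1 γ) (isLoop_siteLoopCurve 1 γ))},
        2 * Real.cos ((∫ z in {z : ℂ | u.wind z ≠ 0}, δ ^ 2 * f ((δ : ℂ) * z)) + Real.pi / 3) := by
  rw [loopSet_eq_image δ cfg, finprod_mem_image (imageOn_mul_injective hδ.ne').injOn]
  refine finprod_mem_congr rfl fun u _ ↦ ?_
  rw [setOf_wind_imageOn_mul_ne_zero hδ u, setIntegral_smul_set_eq f hδ]

/-! ## The stub -/

/-- **Stub `stub_dilation` of line `Sketch` (crux `MagicFormulaT`).** The exact lattice identity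
`Λ^𝕋_δ(f) = Λ^𝕋_1(f_δ)`, `f_δ(w) = δ² f(δw)`, for every `f : ℂ → ℝ` and every `δ > 0`: the interface
loops of `δ𝕋` are the images of those of `𝕋` under `z ↦ δz`, `W(δu, δw) = W(u, w)`,
`{W(δu,·) ≠ 0} = δ • {W(u,·) ≠ 0}`, and `∫_{δ•A} f = δ² ∫_A f(δ·)`. -/
theorem stub_dilation : ∀ (f : ℂ → ℝ) (δ : ℝ), 0 < δ →
    (∫ cfg, (∏ᶠ u ∈ {u : UnbasedLoop ℂ | ∃ (v : HexVertex) (γ : hexGraph.Walk v v),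
        IsSiteInterfaceLoop cfg γ ∧
          u = UnbasedLoop.mk (BasedLoop.mk (siteLoopCurve δ γ) (isLoop_siteLoopCurve δ γ))},
        2 * Real.cos ((∫ z in {z : ℂ | u.wind z ≠ 0}, f z) + Real.pi / 3)) ∂(triSitePercolation half)) =
      ∫ cfg, (∏ᶠ u ∈ {u : UnbasedLoop ℂ | ∃ (v : HexVertex) (γ : hexGraph.Walk v v),
        IsSiteInterfaceLoop cfg γ ∧
          u = UnbasedLoop.mk (BasedLoop.mk (siteLoopCurve 1 γ) (isLoop_siteLoopCurve 1 γ))},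
        2 * Real.cos ((∫ z in {z : ℂ | u.wind z ≠ 0}, δ ^ 2 * f ((δ : ℂ) * z)) + Real.pi / 3))
          ∂(triSitePercolation half) := by
  intro f δ hδ
  exact integral_congr_ae (Eventually.of_forall fun cfg ↦ finprod_loopWeight_dilate f hδ cfg)

end Summit.CriticalPhenomena.CardyFormulaZ2.Cruxes.MagicFormulaT.LineSketch

end
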